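import Summits.ValiantsHypothesis.ValiantsHypothesis.Theorems.KPlusLogSqLawTropicalBWalkDesignDefs

/-!
# Route `KPlusLogSqLaw`, crux `TropicalB` — walk designs, I: entries, the walk permutation, sign and weight of a walk term

HONEST FRAMING.  Helper file (negative-side calibration) toward the registered stubs `stub_tropThin` / `stub_tropFat` of
`Cruxes/TropicalB/Lines/birth.lean` (crux `TropicalB`, ledger item `stmt-ValiantsHypothesis-19771`, route `KPlusLogSqLaw`,
DRAFT; cell `pub-symmetroid`, seat `val-sym-trop-p1`, 2026-08-26).  Nothing here proves any part of a stub; nothing asserts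
`TropicalB`, `KPlusLogSqLaw`, `MatrixDescartes` or anything about `VP ≠ VNP`.

For the walk design of `…TropicalBWalkDesignDefs` (diagonal entries of class `l₀`, layer entries from `lay`, back entries
into the column `(0, v₀)` with valuation `−Ω`) this file proves, for a walk `y` (`IsLayWalk lay v₀ y`):
* entry lemmas (`walkEpsP_self`, `walkEpsP_layer`, `walkEpsP_back`, `walkEpsP_cases`, and the `walkValP` versions);
* the walk permutation: `walkPerm_apply_cycle`, `walkPerm_apply_of_ne`, `walkPerm_zero`, `walkPerm_succ`, its iterates
  (`walkPerm_pow_apply_cycle`), `isCycle_walkPerm`, its support (`walkPerm_ne_iff`, `support_walkPerm`) and its SIGN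
  `sign_walkPerm : (sign (walkPerm y) : ℤ) = (−1)^T` (a `(T+1)`-cycle);
(the walk term's sign and weight on `Fin m` are in the companion file …TropicalBWalkDesignWeights).
All [folklore] (the WalkDet bookkeeping of the tree's staircase refutation, term by term instead of by a determinant identity).
-/

set_option linter.dupNamespace false
set_option autoImplicit false

namespace Summit.ValiantsHypothesis.ValiantsHypothesis.Theorems.KPlusLogSqLaw.WalkDesign

open Summit.ValiantsHypothesis.ValiantsHypothesis.Theorems.MatrixDescartes.Negative
open Summit.ValiantsHypothesis.ValiantsHypothesis.Theorems.SymmetroidDescartes.DPR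
open scoped BigOperators
open Finset

variable {V : Type*} {T K : ℕ}

/-! ## 1. Entries -/

section Layer

variable (lay : Fin T → V → V → Option (WEdge K))

/-- the layer edge between consecutive layers is the layer's edge. -/
theorem layerEdge_succ (s : Fin T) (x x' : V) : layerEdge lay (s.castSucc, x) (s.succ, x') = lay s x x' := by
  unfold layerEdge
  have h : (s.succ : Fin (T + 1)).val = (s.castSucc : Fin (T + 1)).val + 1 := by simp
  rw [dif_pos h]
  simp only [Fin.val_castSucc, Fin.eta]

/-- no layer edge unless the column layer is the row layer plus one. -/
theorem layerEdge_eq_none {r c : Fin (T + 1) × V} (h : c.1.val ≠ r.1.val + 1) : layerEdge lay r c = none := by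
  unfold layerEdge; rw [dif_neg h]

/-- a layer edge forces the layers to be consecutive. -/
theorem layer_of_layerEdge {r c : Fin (T + 1) × V} {e : WEdge K} (h : layerEdge lay r c = some e) :
    c.1.val = r.1.val + 1 := by
  by_contra hne
  rw [layerEdge_eq_none lay hne] at h
  exact absurd h (by simp)

/-- a layer edge, read back as an edge of its layer. -/
theorem lay_of_layerEdge {r c : Fin (T + 1) × V} {e : WEdge K} (h : layerEdge lay r c = some e) :
    ∃ hs : r.1.val < T, lay ⟨r.1.val, hs⟩ r.2 c.2 = some e := by
  have hl := layer_of_layerEdge lay h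
  have hs : r.1.val < T := by have := c.1.isLt; omega
  refine ⟨hs, ?_⟩
  unfold layerEdge at h
  rw [dif_pos hl] at h
  exact h

end Layer

section Entries

variable [DecidableEq V] (lay : Fin T → V → V → Option (WEdge K)) (l₀ : Fin K) (Ω : ℤ) (v₀ : V)

/-- diagonal entries: class `l₀`, sign `+1`. -/
theorem walkEpsP_self (i : Fin (T + 1) × V) (l : Fin K) :
    walkEpsP lay l₀ v₀ i i l = if l = l₀ then 1 else 0 := by
  unfold walkEpsP; rw [if_pos rfl]

/-- diagonal entries: valuation `0`. -/
theorem walkValP_self (i : Fin (T + 1) × V) (l : Fin K) : walkValP lay Ω v₀ i i l = 0 := by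
  unfold walkValP; rw [if_pos rfl]

/-- layer entries: the edge's class and sign. -/
theorem walkEpsP_layer {r c : Fin (T + 1) × V} (hrc : r ≠ c) {e : WEdge K} (he : layerEdge lay r c = some e)
    (l : Fin K) : walkEpsP lay l₀ v₀ r c l = if l = e.cls then e.sgn else 0 := by
  unfold walkEpsP; rw [if_neg hrc, he]

/-- layer entries: the edge's weight. -/
theorem walkValP_layer {r c : Fin (T + 1) × V} (hrc : r ≠ c) {e : WEdge K} (he : layerEdge lay r c = some e)
    (l : Fin K) : walkValP lay Ω v₀ r c l = e.a := by
  unfold walkValP; rw [if_neg hrc, he]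

omit [DecidableEq V] in
/-- a row in the last layer differs from the column `(0, v₀)` (`T ≥ 1`). -/
theorem last_ne_zero_pair (hT : 0 < T) (x : V) : ((Fin.last T, x) : Fin (T + 1) × V) ≠ (0, v₀) := by
  intro h
  have := congrArg (fun p : Fin (T + 1) × V => p.1.val) h
  simp at this
  omega

/-- back entries (row in the last layer, column `(0, v₀)`; `T ≥ 1`): class `l₀`, sign `+1`. -/
theorem walkEpsP_back (hT : 0 < T) (x : V) (l : Fin K) :
    walkEpsP lay l₀ v₀ (Fin.last T, x) (0, v₀) l = if l = l₀ then 1 else 0 := by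
  have hle : layerEdge lay (Fin.last T, x) (0, v₀) = none := layerEdge_eq_none lay (by simp)
  unfold walkEpsP
  rw [if_neg (last_ne_zero_pair v₀ hT x), hle]
  simp

/-- back entries: valuation `−Ω`. -/
theorem walkValP_back (hT : 0 < T) (x : V) (l : Fin K) :
    walkValP lay Ω v₀ (Fin.last T, x) (0, v₀) l = -Ω := by
  have hle : layerEdge lay (Fin.last T, x) (0, v₀) = none := layerEdge_eq_none lay (by simp)
  unfold walkValP
  rw [if_neg (last_ne_zero_pair v₀ hT x), hle]
  simp

/-- **Entry inversion.**  A present entry is diagonal (class `l₀`), or a layer entry (class of its edge), or a back entry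
(row in layer `T`, column `(0, v₀)`, class `l₀`). -/
theorem walkEpsP_cases {r c : Fin (T + 1) × V} {l : Fin K} (h : walkEpsP lay l₀ v₀ r c l ≠ 0) :
    (r = c ∧ l = l₀) ∨
    (r ≠ c ∧ ∃ e, layerEdge lay r c = some e ∧ l = e.cls) ∨
    (r ≠ c ∧ layerEdge lay r c = none ∧ r.1 = Fin.last T ∧ c.1 = 0 ∧ c.2 = v₀ ∧ l = l₀) := by
  unfold walkEpsP at h
  by_cases hrc : r = c
  · rw [if_pos hrc] at h
    refine Or.inl ⟨hrc, ?_⟩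
    by_contra hl; exact h (if_neg hl)
  · rw [if_neg hrc] at h
    right
    cases hle : layerEdge lay r c with
    | some e =>
      rw [hle] at h
      refine Or.inl ⟨hrc, e, rfl, ?_⟩
      by_contra hl; exact h (if_neg hl)
    | none =>
      rw [hle] at h
      simp only at h
      by_cases hb : r.1 = Fin.last T ∧ c.1 = 0 ∧ c.2 = v₀
      · rw [if_pos hb] at h
        refine Or.inr ⟨hrc, rfl, hb.1, hb.2.1, hb.2.2, ?_⟩
        by_contra hl; exact h (if_neg hl)
      · rw [if_neg hb] at h
        exact absurd rfl h

end Entries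

/-! ## 2. The walk permutation -/

/-- `(finRotate (T+1))⁻¹ 0 = T`. -/
theorem finRotate_symm_zero : (finRotate (T + 1)).symm 0 = Fin.last T := by
  rw [Equiv.symm_apply_eq]; exact (finRotate_last).symm

/-- `(finRotate (T+1))⁻¹ (s+1) = s`. -/
theorem finRotate_symm_succ (s : Fin T) : (finRotate (T + 1)).symm s.succ = s.castSucc := by
  rw [Equiv.symm_apply_eq, finRotate_apply, Fin.coeSucc_eq_succ]

/-- powers of `finRotate` on `0`: `(finRotate (T+1))^k 0 = k` for `k ≤ T`. -/
theorem finRotate_pow_zero (k : ℕ) (hk : k ≤ T) : (finRotate (T + 1) ^ k) 0 = ⟨k, by omega⟩ := by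
  induction k with
  | zero => simp
  | succ k ih =>
    rw [pow_succ', Equiv.Perm.mul_apply, ih (by omega), finRotate_apply]
    apply Fin.ext
    rw [Fin.val_add_one_of_lt (by rw [Fin.lt_def]; simp; omega)]

/-- `(finRotate (T+1))⁻¹ t ≠ t` for `T ≥ 1`. -/
theorem finRotate_symm_ne (hT : 0 < T) (t : Fin (T + 1)) : (finRotate (T + 1)).symm t ≠ t := by
  intro h1
  have h2 : finRotate (T + 1) t = t := by
    conv_lhs => rw [← h1]
    rw [Equiv.apply_symm_apply]
  rw [finRotate_apply] at h2
  have h3 := congrArg Fin.val h2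
  rw [Fin.val_add] at h3
  have ht := t.isLt
  simp only [Fin.val_one'] at h3
  rw [Nat.mod_eq_of_lt (by omega : 1 < T + 1)] at h3
  rcases Nat.lt_or_ge (t.val + 1) (T + 1) with hlt | hge
  · rw [Nat.mod_eq_of_lt hlt] at h3; omega
  · have : t.val + 1 = T + 1 := by omega
    rw [this, Nat.mod_self] at h3; omega

section Perm

variable [DecidableEq V] (y : Fin (T + 1) → V)

/-- on a cycle point the walk permutation steps the layer back. -/
theorem walkPerm_apply_cycle (t : Fin (T + 1)) :
    walkPerm y (t, y t) = ((finRotate (T + 1)).symm t, y ((finRotate (T + 1)).symm t)) := by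
  show (if y t = y t then _ else _) = _
  rw [if_pos rfl]

/-- off the cycle points the walk permutation is the identity. -/
theorem walkPerm_apply_of_ne {c : Fin (T + 1) × V} (h : c.2 ≠ y c.1) : walkPerm y c = c := by
  show (if c.2 = y c.1 then _ else _) = _
  rw [if_neg h]

/-- the back step: `(0, y 0) ↦ (T, y T)`. -/
theorem walkPerm_zero : walkPerm y (0, y 0) = (Fin.last T, y (Fin.last T)) := by
  rw [walkPerm_apply_cycle, finRotate_symm_zero]

/-- the layer steps: `(s+1, y (s+1)) ↦ (s, y s)`. -/
theorem walkPerm_succ (s : Fin T) : walkPerm y (s.succ, y s.succ) = (s.castSucc, y s.castSucc) := by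
  rw [walkPerm_apply_cycle, finRotate_symm_succ]

/-- moved points of the walk permutation are exactly the cycle points (`T ≥ 1`). -/
theorem walkPerm_ne_iff (hT : 0 < T) (c : Fin (T + 1) × V) : walkPerm y c ≠ c ↔ c.2 = y c.1 := by
  constructor
  · intro h
    by_contra hne
    exact h (walkPerm_apply_of_ne y hne)
  · intro h heq
    obtain ⟨t, x⟩ := c
    simp only at h
    subst h
    rw [walkPerm_apply_cycle] at heq
    exact finRotate_symm_ne hT t (congrArg Prod.fst heq)

/-- iterates of the walk permutation on cycle points. -/
theorem walkPerm_pow_apply_cycle (k : ℕ) (t : Fin (T + 1)) :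
    (walkPerm y ^ k) (t, y t) = (((finRotate (T + 1))⁻¹ ^ k) t, y (((finRotate (T + 1))⁻¹ ^ k) t)) := by
  induction k with
  | zero => simp
  | succ k ih =>
    rw [pow_succ', Equiv.Perm.mul_apply, ih, walkPerm_apply_cycle, pow_succ', Equiv.Perm.mul_apply]
    rfl

/-- every cycle point is in the cycle of `(0, y 0)`. -/
theorem sameCycle_walkPerm (t : Fin (T + 1)) : (walkPerm y).SameCycle (t, y t) (0, y 0) := by
  refine ⟨(t.val : ℤ), ?_⟩
  rw [zpow_natCast, walkPerm_pow_apply_cycle]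
  have h1 := finRotate_pow_zero (T := T) t.val (by have := t.isLt; omega)
  have h2 : (⟨t.val, by omega⟩ : Fin (T + 1)) = t := Fin.ext rfl
  rw [h2] at h1
  have h3 : ((finRotate (T + 1))⁻¹ ^ t.val) ((finRotate (T + 1) ^ t.val) 0) = 0 := by
    rw [← Equiv.Perm.mul_apply, inv_pow, inv_mul_cancel, Equiv.Perm.one_apply]
  rw [h1] at h3
  rw [h3]

/-- the walk permutation is a cycle (`T ≥ 1`). -/
theorem isCycle_walkPerm (hT : 0 < T) : (walkPerm y).IsCycle := by
  refine ⟨(0, y 0), (walkPerm_ne_iff y hT _).mpr rfl, fun c hc => ?_⟩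
  have h := (walkPerm_ne_iff y hT c).mp hc
  obtain ⟨t, x⟩ := c
  simp only at h
  subst h
  exact (sameCycle_walkPerm y t).symm

variable [Fintype V]

/-- the support of the walk permutation is the set of cycle points. -/
theorem support_walkPerm (hT : 0 < T) :
    (walkPerm y).support = (univ : Finset (Fin (T + 1))).image fun t => (t, y t) := by
  ext c
  rw [Equiv.Perm.mem_support, walkPerm_ne_iff y hT, mem_image]
  constructor
  · intro h; exact ⟨c.1, mem_univ _, Prod.ext rfl h.symm⟩
  · rintro ⟨t, _, rfl⟩; rfl

/-- the walk permutation has `T + 1` moved points. -/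
theorem card_support_walkPerm (hT : 0 < T) : (walkPerm y).support.card = T + 1 := by
  rw [support_walkPerm y hT, card_image_of_injective _ (fun t t' h => by simpa using congrArg Prod.fst h),
    card_univ, Fintype.card_fin]

/-- **The sign of the walk permutation is `(−1)^T`** (a `(T+1)`-cycle). -/
theorem sign_walkPerm (hT : 0 < T) : (Equiv.Perm.sign (walkPerm y) : ℤ) = (-1) ^ T := by
  have h := (isCycle_walkPerm y hT).sign
  rw [card_support_walkPerm y hT] at h
  rw [h, Units.val_neg, Units.val_pow_eq_pow_val, Units.val_neg, Units.val_one]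
  ring

end Perm

end Summit.ValiantsHypothesis.ValiantsHypothesis.Theorems.KPlusLogSqLaw.WalkDesign
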